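import Summits.MatrixMultiplication.MatrixMultiplication.Theorems.SoloInformedTwistedSliceRank
import Mathlib.Algebra.Polynomial.Roots
import Mathlib.RingTheory.Localization.FractionRing
import Mathlib.Algebra.CharP.Algebra
import Mathlib.Data.ZMod.Basic
import HarnessLib

/-!
# Twisted matchings in `H^T` are exponentially small; realizations of `⟨n,n,n⟩` in coordinatewise-twisted translation structures

Solo-informed seat (MatrixMultiplication), gen 101; sequel of `SoloInformedTwistedSliceRank.lean`
(the twisted codimension bound). Kernel form of the slice-rank half of the seat's Theorems B/B″
(sharpest-statement §2y(7)–(8)) for DIAGONAL multiplier groups: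

* `card_le_of_coordTwistedMatching` — Sawin's adapted tensor basis of `K[H^T]` (`char K ∣ |H|`)
  packaged as `GradedCoords`, and the observation that COORDINATEWISE AUTOMORPHISM twists
  `y ↦ (e_t(y_t))_t` are filtered for it (`coordTwist_filtered_mid/right`: `e_t` permutes the
  `β_g`, `g ≠ 1`, and fixes `σ`); hence a weighted twisted matching has
  `|ι| ≤ 2 #{deg < a} + #{deg ≥ 2a}` for every `a`, whatever the number of twists.
* `exists_coordTwistedMatching_le` — the exponential form `|ι| ≤ 3 δ^{|T|} |H|^{|T|}`, `δ < 1`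
  depending only on `|H|` (thresholds and rates exactly as in Sawin 2018, Lemma 1.3).
* `exists_weights` — over an infinite field, weights with all prescribed non-empty set-sums
  non-zero exist (`t_s = u^{m(s)}`, `u` not a root of `∏_i Σ_{s ∈ Sol_i} X^{m(s)}`).
* `exists_twistedMatching_card_le` — the WEIGHT-FREE statement: for a non-trivial finite group
  `H` there is `δ < 1` such that every family `(x_i,y_i,z_i)` in `(H^T)^3` with
  `(∃ s, x_i · e_s(y_j) · e'_s(z_l) = 1) ⟺ i = j = l` has `|ι| ≤ 3 δ^{|T|} |H|^{|T|}`
  (field `Frac(𝔽_p[X])`, `p ∣ |H|`).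
* `realization_inducedMatching_card_le` — if `α, β, γ : [n]² → H^T` realize `⟨n,n,n⟩` for the
  twisted triangle predicate in the sense of Cohn–Umans 2013, Def. 12, then every induced
  matching of the matrix-multiplication support has at most `3 δ^{|T|} |H|^{|T|}` elements. With
  `H = 𝔽_p`, `T = [k]`, scalar twists `M₀ × M₀` this is the translation scheme `𝒮(𝔽_p^k, M₀)`,
  `M₀` diagonal; since the support of `⟨n,n,n⟩` has induced matchings of size `n^{2-o(1)}`
  (Behrend), such schemes realize `⟨n,n,n⟩` only when `n^{2-o(1)} ≤ 3(δ_p p)^k`, and cannot carry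
  Cohn–Umans Conj. 21 in bounded characteristic. General (non-diagonal) `M₀ ≤ GL_k(𝔽_p)` needs the
  Jennings basis (powers of the augmentation ideal are `GL_k`-stable) in place of Sawin's; the
  abstract bound `card_le_of_twistedMatching` already covers it once that filteredness is supplied.

References: Sawin2018 (arXiv:1702.00905) Lemma 1.3 (via the tree's `NilpotentGroupBarrierSawin`); BlasiakChurchCohnGrochowUmans2017 Prop. 3.2; BlasiakChurchCohnGrochowNaslundSawinUmans2017
Lemma 4.7, Prop. 4.8; CohnUmans2013 (arXiv:1207.6528) Def. 12, Conj. 21.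
-/

noncomputable section

open scoped BigOperators
open Finset Literature.Combinatorics.Additive Literature.Barriers.MatrixMultiplication

namespace Summit.MatrixMultiplication.MatrixMultiplication.Theorems.TwistedSliceRank

/-! ## Coordinatewise automorphism twists on `K[H^T]` are filtered for Sawin's tensor basis -/

section CoordTwists

universe u' v' w'

variable {K : Type v'} [Field K] {H : Type u'} [Group H] [Fintype H] [DecidableEq H]
  {T : Type w'} [Fintype T] [DecidableEq T] {σ : Type*} [Fintype σ]

omit [Fintype H] [DecidableEq T] in
/-- If `deg j < deg j'` then `j'` has a `σ`-coordinate where `j` has none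
(`{t : j' t = 1} ⊄ {t : j t = 1}`). [folklore] -/
theorem exists_coord_of_sawinDeg_lt {j j' : T → H} (h : sawinDeg j < sawinDeg j') :
    ∃ t, j' t = 1 ∧ j t ≠ 1 := by
  by_contra hno'
  have hno : ∀ t, j' t = 1 → j t = 1 := fun t ht => by
    by_contra hjt
    exact hno' ⟨t, ht, hjt⟩
  have : sawinDeg j' ≤ sawinDeg j := by
    unfold sawinDeg
    refine Finset.sum_le_sum fun t _ => ?_
    unfold degOne
    by_cases h1 : j' t = 1
    · simp [h1, hno t h1]
    · simp [h1]
  omega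

/-- Middle-leg filteredness of a coordinatewise twist `y ↦ (e_t (y t))_t` by automorphisms:
the push-forward of `β_{j'}` has no `β_j`-component with `deg j < deg j'` (indeed `e_t` permutes
`{β_g : g ≠ 1}` and fixes `σ`). [this work] -/
theorem coordTwist_filtered_mid (e : T → H ≃* H) (j' j : T → H)
    (h : sawinDeg j < sawinDeg j') :
    ∑ x' : T → H, (sawinPT j' x' * sawinQT (fun t => e t (x' t)) j : K) = 0 := by
  obtain ⟨t₀, h1, h2⟩ := exists_coord_of_sawinDeg_lt h
  have hprod : ∀ x' : T → H, (sawinPT j' x' * sawinQT (fun t => e t (x' t)) j : K) =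
      ∏ t, (sawinP (j' t) (x' t) * sawinQ (e t (x' t)) (j t)) := fun x' => by
    rw [sawinPT, sawinQT, ← Finset.prod_mul_distrib]
  simp_rw [hprod]
  rw [← Fintype.prod_sum (fun t g => (sawinP (j' t) g * sawinQ (e t g) (j t) : K))]
  refine Finset.prod_eq_zero (Finset.mem_univ t₀) ?_
  simp only [h1, sawinP_one, one_mul]
  have hre : ∑ g, (sawinQ ((e t₀) g) (j t₀) : K) = ∑ g, (sawinQ g (j t₀) : K) :=
    Fintype.sum_equiv (e t₀).toEquiv _ _ (fun g => rfl)
  rw [hre, sum_sawinQ]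
  simp [h2]

/-- Right-leg filteredness of a coordinatewise twist by automorphisms. [this work] -/
theorem coordTwist_filtered_right (e : T → H ≃* H) (k k' : T → H)
    (h : sawinDeg k' < sawinDeg k) :
    ∑ b : T → H, (sawinPT k ((fun t => e t (b⁻¹ t)) : T → H)⁻¹ * sawinQT b k' : K) = 0 := by
  obtain ⟨t₀, h1, h2⟩ := exists_coord_of_sawinDeg_lt h
  have hinv : ∀ b : T → H, ((fun t => e t (b⁻¹ t)) : T → H)⁻¹ = fun t => e t (b t) := by
    intro b; funext t; simp [Pi.inv_apply, map_inv, inv_inv]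
  simp_rw [hinv]
  have hprod : ∀ b : T → H, (sawinPT k (fun t => e t (b t)) * sawinQT b k' : K) =
      ∏ t, (sawinP (k t) (e t (b t)) * sawinQ (b t) (k' t)) := fun b => by
    rw [sawinPT, sawinQT, ← Finset.prod_mul_distrib]
  simp_rw [hprod]
  rw [← Fintype.prod_sum (fun t g => (sawinP (k t) (e t g) * sawinQ g (k' t) : K))]
  refine Finset.prod_eq_zero (Finset.mem_univ t₀) ?_
  simp only [h1, sawinP_one, one_mul]
  rw [sum_sawinQ]
  simp [h2]

/-- **Coordinatewise-twisted matchings in `H^T` are small (combinatorial form).** Let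
`char K ∣ |H|`. If `x_i · e_s(y_j) · e'_s(z_l) = 1` for some twist `s` (each twist acting on
every coordinate by a group automorphism of `H`) forces `i = j = l`, and the diagonal weight sums
are non-zero, then `|ι| ≤ 2 #{i ∈ H^T : deg i < a} + #{k : 2a ≤ deg k}` for every threshold `a`
(deg = number of trivial coordinates). With all twists trivial this is Sawin 2018, Lemma 1.3 for
multiplicative matchings; the point is that the bound does not see the number of twists.
[this work] -/
theorem card_le_of_coordTwistedMatching (hH : (Fintype.card H : K) = 0) (t : σ → K)
    (e e' : σ → T → H ≃* H) {ι : Type*} [Fintype ι] (x y z : ι → T → H)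
    (hoff : ∀ (i j l : ι) (s : σ),
      x i * (fun t' => e s t' (y j t')) * (fun t' => e' s t' (z l t')) = 1 → i = j ∧ j = l)
    (hdiag : ∀ i : ι, (∑ s, t s *
      (if x i * (fun t' => e s t' (y i t')) * (fun t' => e' s t' (z i t')) = 1 then (1 : K)
        else 0)) ≠ 0)
    (a : ℕ) :
    Fintype.card ι ≤ Fintype.card {i : T → H // sawinDeg i < a} +
      Fintype.card {i : T → H // sawinDeg i < a} + Fintype.card {k : T → H // a + a ≤ sawinDeg k} :=
  card_le_of_twistedMatching
    (⟨sawinPT, sawinQT, sawinDeg, sum_sawinQT_mul_sawinPT, sawinC_graded hH⟩ :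
      GradedCoords K (T → H) (T → H))
    t (fun s y => fun t' => e s t' (y t')) (fun s z => fun t' => e' s t' (z t'))
    (fun s j' j hlt => coordTwist_filtered_mid (e s) j' j hlt)
    (fun s k k' hlt => coordTwist_filtered_right (e' s) k k' hlt) x y z hoff hdiag a a

/-- **Coordinatewise-twisted matchings in `H^T` are exponentially small.** With
`char K ∣ |H|` there is `δ < 1` depending only on `|H|` such that every coordinatewise-twisted
matching in `H^T` with non-zero diagonal weight sums has at most `3 δ^{|T|} |H|^{|T|}` elements —
for any number of twists. For `H = 𝔽_p` and scalar twists this is the slice-rank half of the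
seat's Theorem B (translation schemes `𝒮(𝔽_p^k, M₀)` with `M₀` diagonal cannot carry
Cohn–Umans Conj. 21 in bounded characteristic). Rate as in Sawin 2018, Lemma 1.3.
[this work] -/
theorem exists_coordTwistedMatching_le (hH : (Fintype.card H : K) = 0) :
    ∃ δ : ℝ, 0 < δ ∧ δ < 1 ∧ ∀ (T : Type) [Fintype T] [DecidableEq T] (σ : Type) [Fintype σ]
      (t : σ → K) (e e' : σ → T → H ≃* H) (ι : Type) [Fintype ι] (x y z : ι → T → H),
      (∀ (i j l : ι) (s : σ),
        x i * (fun t' => e s t' (y j t')) * (fun t' => e' s t' (z l t')) = 1 → i = j ∧ j = l) →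
      (∀ i : ι, (∑ s, t s *
        (if x i * (fun t' => e s t' (y i t')) * (fun t' => e' s t' (z i t')) = 1 then (1 : K)
          else 0)) ≠ 0) →
      (Fintype.card ι : ℝ) ≤ 3 * δ ^ Fintype.card T * (Fintype.card H : ℝ) ^ Fintype.card T := by
  -- constants (as in Sawin 2018, Lemma 1.3)
  have hGpos : (0 : ℝ) < Fintype.card H := by exact_mod_cast Fintype.card_pos
  set q : ℝ := 1 / (Fintype.card H : ℝ) with hq
  have hq0 : 0 < q := by positivity
  set A : ℝ := (Fintype.card H : ℝ) - 1 with hA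
  set δ₁ : ℝ := (7 / 8 : ℝ) ^ (-(3 * q / 4)) * (1 - q / 8) with hδ₁
  set δ₂ : ℝ := (5 / 4 : ℝ) ^ (-(3 * q / 2)) * (1 + q / 4) with hδ₂
  have hδ₁1 : δ₁ < 1 := sawin_rate_one_lt hq0
  have hδ₂1 : δ₂ < 1 := sawin_rate_two_lt hq0
  have hq1 : q ≤ 1 := by
    rw [hq, div_le_one hGpos]; exact_mod_cast Fintype.card_pos
  have hδ₁0 : 0 < δ₁ := by
    have : 0 < 1 - q / 8 := by linarith
    positivity
  have hδ₂0 : 0 < δ₂ := by positivity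
  refine ⟨max δ₁ δ₂, lt_max_of_lt_left hδ₁0, max_lt hδ₁1 hδ₂1,
    fun T _ _ σ _ t e e' ι _ x y z hoff hdiag => ?_⟩
  set n : ℕ := Fintype.card T with hn
  set a : ℕ := ⌈3 * q * n / 4⌉₊ with ha
  have ha1 : (a : ℝ) < 3 * q * n / 4 + 1 := Nat.ceil_lt_add_one (by positivity)
  have ha2 : 3 * q * n / 4 ≤ a := Nat.le_ceil _
  -- the combinatorial bound
  have hsr := card_le_of_coordTwistedMatching hH t e e' x y z hoff hdiag a
  have hsr' : (Fintype.card ι : ℝ) ≤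
      (Fintype.card {i : T → H // sawinDeg i < a} : ℝ) +
        (Fintype.card {i : T → H // sawinDeg i < a} : ℝ) +
        (Fintype.card {k : T → H // a + a ≤ sawinDeg k} : ℝ) := by exact_mod_cast hsr
  -- the two tails
  have hr0 : (0 : ℝ) < 7 / 8 := by norm_num
  have hR1 : (1 : ℝ) ≤ 5 / 4 := by norm_num
  have h78 : (7 / 8 : ℝ) + A = (1 - q / 8) * Fintype.card H := by
    rw [hA, hq]; field_simp; ring
  have h54 : (5 / 4 : ℝ) + A = (1 + q / 4) * Fintype.card H := by
    rw [hA, hq]; field_simp; ring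
  have htail1 : (Fintype.card {i : T → H // sawinDeg i < a} : ℝ) ≤
      δ₁ ^ n * (Fintype.card H : ℝ) ^ n := by
    refine (card_sawinDeg_lt_le hr0 (by norm_num) a).trans ?_
    rw [h78, ← hn]
    have h1 : (7 / 8 : ℝ) ^ ((1 : ℝ) - a) ≤ (7 / 8 : ℝ) ^ (-(3 * q / 4) * n) :=
      Real.rpow_le_rpow_of_exponent_ge hr0 (by norm_num) (by linarith)
    calc (7 / 8 : ℝ) ^ ((1 : ℝ) - a) * ((1 - q / 8) * Fintype.card H) ^ n
        ≤ (7 / 8 : ℝ) ^ (-(3 * q / 4) * n) * ((1 - q / 8) * Fintype.card H) ^ n :=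
          mul_le_mul_of_nonneg_right h1 (pow_nonneg (mul_nonneg (by linarith) hGpos.le) n)
      _ = δ₁ ^ n * (Fintype.card H : ℝ) ^ n := by
          rw [Real.rpow_mul_natCast hr0.le, hδ₁, mul_pow, mul_pow]; ring
  have htail2 : (Fintype.card {k : T → H // a + a ≤ sawinDeg k} : ℝ) ≤
      δ₂ ^ n * (Fintype.card H : ℝ) ^ n := by
    refine (card_le_sawinDeg_le hR1 (a + a)).trans ?_
    rw [h54, ← hn]
    have h1 : (5 / 4 : ℝ) ^ (-((a + a : ℕ) : ℝ)) ≤ (5 / 4 : ℝ) ^ (-(3 * q / 2) * n) :=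
      Real.rpow_le_rpow_of_exponent_le hR1 (by push_cast; linarith)
    calc (5 / 4 : ℝ) ^ (-((a + a : ℕ) : ℝ)) * ((1 + q / 4) * Fintype.card H) ^ n
        ≤ (5 / 4 : ℝ) ^ (-(3 * q / 2) * n) * ((1 + q / 4) * Fintype.card H) ^ n :=
          mul_le_mul_of_nonneg_right h1 (by positivity)
      _ = δ₂ ^ n * (Fintype.card H : ℝ) ^ n := by
          rw [Real.rpow_mul_natCast (by norm_num), hδ₂, mul_pow, mul_pow]; ring
  -- assemble
  have hm1 : δ₁ ^ n ≤ (max δ₁ δ₂) ^ n := pow_le_pow_left₀ hδ₁0.le (le_max_left _ _) n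
  have hm2 : δ₂ ^ n ≤ (max δ₁ δ₂) ^ n := pow_le_pow_left₀ hδ₂0.le (le_max_right _ _) n
  have hGn : (0 : ℝ) ≤ (Fintype.card H : ℝ) ^ n := by positivity
  calc (Fintype.card ι : ℝ)
      ≤ δ₁ ^ n * (Fintype.card H : ℝ) ^ n + δ₁ ^ n * (Fintype.card H : ℝ) ^ n +
          δ₂ ^ n * (Fintype.card H : ℝ) ^ n := by linarith
    _ ≤ (max δ₁ δ₂) ^ n * (Fintype.card H : ℝ) ^ n + (max δ₁ δ₂) ^ n * (Fintype.card H : ℝ) ^ n +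
          (max δ₁ δ₂) ^ n * (Fintype.card H : ℝ) ^ n := by gcongr
    _ = 3 * (max δ₁ δ₂) ^ n * (Fintype.card H : ℝ) ^ n := by ring

end CoordTwists

end Summit.MatrixMultiplication.MatrixMultiplication.Theorems.TwistedSliceRank

namespace Summit.MatrixMultiplication.MatrixMultiplication.Theorems.TwistedSliceRank

/-! ## Choosing the weights, and the weight-free form of the twisted matching bound -/

section Weights

open Polynomial

/-- Over an infinite field, finitely many non-empty sets of twists admit weights all of whose
set-sums are non-zero (take `t_s = u^{m(s)}` for an injection `m` and `u` outside the roots of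
`∏_i Σ_{s ∈ Sol_i} X^{m(s)}`). [folklore] -/
theorem exists_weights {K : Type*} [Field K] [Infinite K] {ι σ : Type*} [Fintype ι] [Fintype σ]
    (Sol : ι → Finset σ) (hne : ∀ i, (Sol i).Nonempty) :
    ∃ t : σ → K, ∀ i, ∑ s ∈ Sol i, t s ≠ 0 := by
  classical
  let m : σ → ℕ := fun s => ((Fintype.equivFin σ) s : ℕ)
  have hm : Function.Injective m := fun s s' h =>
    (Fintype.equivFin σ).injective (Fin.ext h)
  let P : ι → K[X] := fun i => ∑ s ∈ Sol i, X ^ (m s)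
  have hP : ∀ i, P i ≠ 0 := by
    intro i hzero
    obtain ⟨s₀, hs₀⟩ := hne i
    have hc : (P i).coeff (m s₀) = 1 := by
      simp only [P, finsetSum_coeff, coeff_X_pow]
      simp_rw [hm.eq_iff]
      rw [Finset.sum_ite_eq]
      simp [hs₀]
    rw [hzero, coeff_zero] at hc
    exact zero_ne_one hc
  have hQ : (∏ i, P i) ≠ 0 := Finset.prod_ne_zero_iff.mpr fun i _ => hP i
  have hu : ∃ u : K, ¬ (∏ i, P i).IsRoot u := by
    by_contra hall
    apply hQ
    refine (∏ i, P i).eq_zero_of_infinite_isRoot ?_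
    have hset : {u : K | (∏ i, P i).IsRoot u} = Set.univ :=
      Set.eq_univ_of_forall fun u => by
        by_contra hu
        exact hall ⟨u, hu⟩
    rw [hset]
    exact Set.infinite_univ
  obtain ⟨u, hu⟩ := hu
  refine ⟨fun s => u ^ (m s), fun i hzero => hu ?_⟩
  rw [IsRoot.def, eval_prod]
  refine Finset.prod_eq_zero (Finset.mem_univ i) ?_
  simp only [P, eval_finsetSum, eval_pow, eval_X]
  exact hzero

end Weights

section WeightFree

universe u'

/-- **Twisted matchings are exponentially small (weight-free form).** Let `H` be a non-trivial
finite group. There is `δ < 1` (depending only on `|H|`) such that for every finite family of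
twists `s ↦ (e_s, e'_s)`, each acting on every coordinate of `H^T` by an automorphism of `H`, and
every family `(x_i, y_i, z_i)_{i ∈ ι}` in `(H^T)^3` with
`(∃ s, x_i · e_s(y_j) · e'_s(z_l) = 1) ↔ i = j = l`, one has `|ι| ≤ 3 δ^{|T|} |H|^{|T|}`.
(Field: `Frac(𝔽_p[X])` for a prime `p ∣ |H|`; weights by `exists_weights`; then
`exists_coordTwistedMatching_le`.) For `H = 𝔽_p`, `T = [k]` and scalar twists this says: a
realization of `⟨n,n,n⟩` (Cohn–Umans 2013, Def. 12) in a translation scheme `𝒮(𝔽_p^k, M₀)` with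
`M₀` diagonal forces every induced matching of the matrix-multiplication support used by the
realization to have size `≤ 3 δ_p^k p^k` — so such schemes cannot carry Conj. 21 in bounded
characteristic (sharpest-statement §2y(7)(B), (8)). [this work] -/
theorem exists_twistedMatching_card_le (H : Type u') [Group H] [Fintype H] [DecidableEq H]
    [Nontrivial H] :
    ∃ δ : ℝ, 0 < δ ∧ δ < 1 ∧ ∀ (T : Type) [Fintype T] [DecidableEq T] (σ : Type) [Fintype σ]
      (e e' : σ → T → H ≃* H) (ι : Type) [Fintype ι] (x y z : ι → T → H),
      (∀ i j l : ι, (∃ s : σ,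
        x i * (fun t' => e s t' (y j t')) * (fun t' => e' s t' (z l t')) = 1) ↔ (i = j ∧ j = l)) →
      (Fintype.card ι : ℝ) ≤ 3 * δ ^ Fintype.card T * (Fintype.card H : ℝ) ^ Fintype.card T := by
  classical
  obtain ⟨p, hp, hpd⟩ := Nat.exists_prime_and_dvd (Fintype.one_lt_card (α := H)).ne'
  haveI : Fact p.Prime := ⟨hp⟩
  have hinj : Function.Injective
      (algebraMap (Polynomial (ZMod p)) (FractionRing (Polynomial (ZMod p)))) :=
    IsFractionRing.injective (Polynomial (ZMod p)) (FractionRing (Polynomial (ZMod p)))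
  haveI : CharP (FractionRing (Polynomial (ZMod p))) p := charP_of_injective_algebraMap hinj p
  haveI : Infinite (FractionRing (Polynomial (ZMod p))) := Infinite.of_injective _ hinj
  have hH : (Fintype.card H : FractionRing (Polynomial (ZMod p))) = 0 :=
    (CharP.cast_eq_zero_iff (FractionRing (Polynomial (ZMod p))) p _).mpr hpd
  obtain ⟨δ, hδ0, hδ1, hmain⟩ := exists_coordTwistedMatching_le hH
  refine ⟨δ, hδ0, hδ1, fun T _ _ σ _ e e' ι _ x y z hmatch => ?_⟩
  let Sol : ι → Finset σ := fun i => Finset.univ.filter fun s =>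
    x i * (fun t' => e s t' (y i t')) * (fun t' => e' s t' (z i t')) = 1
  have hSol : ∀ i, (Sol i).Nonempty := fun i => by
    obtain ⟨s, hs⟩ := (hmatch i i i).2 ⟨rfl, rfl⟩
    exact ⟨s, by simp [Sol, hs]⟩
  obtain ⟨t, ht⟩ := exists_weights (K := FractionRing (Polynomial (ZMod p))) Sol hSol
  refine hmain T σ t e e' ι x y z (fun i j l s h => (hmatch i j l).1 ⟨s, h⟩) fun i => ?_
  have hsum : (∑ s, t s * (if x i * (fun t' => e s t' (y i t')) * (fun t' => e' s t' (z i t')) = 1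
      then (1 : FractionRing (Polynomial (ZMod p))) else 0)) = ∑ s ∈ Sol i, t s := by
    rw [Finset.sum_filter]
    exact Finset.sum_congr rfl fun s _ => by split_ifs <;> simp
  rw [hsum]
  exact ht i

end WeightFree

end Summit.MatrixMultiplication.MatrixMultiplication.Theorems.TwistedSliceRank

namespace Summit.MatrixMultiplication.MatrixMultiplication.Theorems.TwistedSliceRank

section Realization

universe u'

/-- **Realizations of `⟨n,n,n⟩` in coordinatewise-twisted translation structures have small
induced matchings.** Let `H` be a non-trivial finite group and let the "triangle" predicate on
`(H^T)^3` be `Tri(g₁,g₂,g₃) :⟺ ∃ s, g₁ · e_s(g₂) · e'_s(g₃) = 1` for a finite family of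
coordinatewise automorphism twists (for `H^T = 𝔽_p^k` and scalar twists `M₀ × M₀` this is the
triangle relation of the translation scheme `𝒮(𝔽_p^k, M₀)` on orbit representatives). If
maps `α, β, γ : [n]² → H^T` REALIZE `⟨n,n,n⟩` in the sense of Cohn–Umans 2013,
Def. 12 — `Tri(α(x), β(y), γ(z)) ⟺ x.2 = y.1 ∧ y.2 = z.1 ∧ z.2 = x.1` — then every INDUCED MATCHING
`(a_i, b_i, c_i)_{i ∈ ι}` of the matrix-multiplication support (`b_j = b_i ∧ c_l = c_j ∧ a_l = a_i
⟹ i = j = l`) has `|ι| ≤ 3 δ^{|T|} |H|^{|T|}` with the `δ < 1` of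
`exists_twistedMatching_card_le`. Since the support of `⟨n,n,n⟩` has induced matchings of size
`n^{2-o(1)}` (Behrend; corner-free sets), such structures realize `⟨n,n,n⟩` only for
`n^{2-o(1)} ≤ 3 (δ|H|)^{|T|}`, which is the seat's Theorem B/B″ for diagonal multiplier groups
(sharpest-statement §2y(7)–(8)). [this work] -/
theorem realization_inducedMatching_card_le (H : Type u') [Group H] [Fintype H] [DecidableEq H]
    [Nontrivial H] :
    ∃ δ : ℝ, 0 < δ ∧ δ < 1 ∧ ∀ (T : Type) [Fintype T] [DecidableEq T] (σ : Type) [Fintype σ]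
      (e e' : σ → T → H ≃* H) (n : ℕ) (α β γ : Fin n × Fin n → T → H),
      (∀ x y z : Fin n × Fin n, (∃ s : σ,
        α x * (fun t' => e s t' (β y t')) * (fun t' => e' s t' (γ z t')) = 1) ↔
          (y.1 = x.2 ∧ z = (y.2, x.1))) →
      ∀ (ι : Type) [Fintype ι] (a b c : ι → Fin n),
        (∀ i j l : ι, b j = b i → c l = c j → a l = a i → i = j ∧ j = l) →
        (Fintype.card ι : ℝ) ≤ 3 * δ ^ Fintype.card T * (Fintype.card H : ℝ) ^ Fintype.card T := by
  obtain ⟨δ, hδ0, hδ1, hmain⟩ := exists_twistedMatching_card_le H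
  refine ⟨δ, hδ0, hδ1, fun T _ _ σ _ e e' n α β γ hreal ι _ a b c hind => ?_⟩
  refine hmain T σ e e' ι (fun i => α (a i, b i)) (fun j => β (b j, c j)) (fun l => γ (c l, a l))
    fun i j l => ?_
  rw [hreal (a i, b i) (b j, c j) (c l, a l)]
  constructor
  · rintro ⟨h1, h2⟩
    simp only [Prod.mk.injEq] at h2
    exact hind i j l h1 h2.1 h2.2
  · rintro ⟨rfl, rfl⟩
    exact ⟨rfl, rfl⟩

end Realization

end Summit.MatrixMultiplication.MatrixMultiplication.Theorems.TwistedSliceRank
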